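import Summits.KontsevichZagierPeriods.Zeta5Search.WedgeDictionaryQPart
import Summits.KontsevichZagierPeriods.Zeta5Search.WedgeDictionaryForms
import Summits.KontsevichZagierPeriods.Zeta5Search.Certificates.DualSeriesTermBounds
import HarnessLib

/-!
# ζ(5) search — certificates: the forms of the census T1-map ray g8 #5 BY NAME (cell `pub-zeta5`, P1 g11)

HONEST FRAMING: systematic search; no irrationality claim unless certified.

OUR work (Summit side; port of certifier 2's `Certificates/RecordRayForms.lean` from Brown–Zudilin's record ray to the
census's top T1-map class g8 #5). The ray is `a·n`, `a = (11,19,14,18,17,23,26,18)` (census g8/g22 class #1; a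
CONVERGENT vector of [BrownZudilin2022, (3)]), with dual parameters `b = b(a·n) = n·(51; 21,19,18,16,15,13,12)`,
`d = 39n`, partner `b′ = b + e₇`. This file fixes, WITHOUT any conjecture, the objects every later certificate of this
ray refers to:

* `c5Q n = Q(a·n) ∈ ℤ` — the printed leading coefficient (17) (`BrownZudilin2022.QOf`);
* `c5P n = ρ(a·n)·(W(b′)V(b) − W(b)V(b′)) ∈ ℚ` — the wedge-dictionary companion (`rhoOf`, `coeffW`, `coeffV`);
* `c5Form n = ρ(a·n)·(W(b′)·F̃₇(b) − W(b)·F̃₇(b′)) ∈ ℝ` — the `ζ(3)`-free combination of two contiguous very-well-poised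
  series (34) (`vwpDual 7`); the slots as naturals `BC5E e n` (`e` = shift of the seventh slot: `e = 0` is `b`,
  `e = 1` is `b′`) in certifier 2's `natB` format, so that the generic dual-series layer
  (`Certificates/DualSeriesTermBounds`) applies verbatim;

and PROVES, for every `n ≥ 1`, `c5Q_eq_wedge : Q(a·n) = ρ(a·n)·(U(b)W(b′) − U(b′)W(b))` (the Q-part of the wedge
dictionary, tree THEOREM `WedgeDictionary.wedgeDictionary_Q`, its side conditions decided here) and
`c5Form_eq : c5Form n = c5Q n · ζ(5) − c5P n` (`WedgeDictionary.zeta3_elimination`). Nothing here is a rate, a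
denominator, or a statement about `ζ(5)`.
-/

noncomputable section

open Finset

namespace Summit.KontsevichZagierPeriods.Zeta5Search.RayC5

open Summit.KontsevichZagierPeriods.Zeta5Search.DualSeries
open Summit.KontsevichZagierPeriods.Zeta5Search.DualSeriesBounds (natB natB_zero natB_succ inBox_natB)
open Summit.KontsevichZagierPeriods.Zeta5Search.WedgeDictionary
open Literature.NumberTheory.Irrationality.BrownZudilin2022 (bOfA Converges QOf vwpDual convergenceForms)
open Literature.NumberTheory.Transcendental (zetaValue)

/-! ### The objects -/

/-- The census g8 class-#5 vector `a = (11,19,14,18,17,23,26,18)`. -/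
def c5Vec : Fin 8 → ℤ := ![11, 19, 14, 18, 17, 23, 26, 18]

/-- The scaled parameters `a·n`. -/
def aC5 (n : ℕ) : Fin 8 → ℤ := fun i => (n : ℤ) * c5Vec i

/-- The dual slots `β = (21,19,18,16,15,13,12)` (index `j` for `β_{j+1}`; `0` beyond). -/
def βC5 (j : ℕ) : ℕ :=
  if j = 0 then 21 else if j = 1 then 19 else if j = 2 then 18 else if j = 3 then 16
  else if j = 4 then 15 else if j = 5 then 13 else if j = 6 then 12 else 0

/-- The natural slots of `b` (`e = 0`) and of the partner `b′ = b + e₇` (`e = 1`): `B_j = β_{j+1}·n + [j = 6]·e`. -/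
def BC5E (e n : ℕ) : ℕ → ℕ := fun j => βC5 j * n + if j = 6 then e else 0

/-- `b = b(a·n) = n·(51; 21,19,18,16,15,13,12)` as an integer vector. -/
def bC5 (n : ℕ) : ℕ → ℤ := natB (51 * n) (BC5E 0 n)

/-- The partner `b′ = b + e₇`. -/
def bC5' (n : ℕ) : ℕ → ℤ := natB (51 * n) (BC5E 1 n)

/-- `Q_n = Q(a·n)`, Brown–Zudilin's leading coefficient (17) on the ray (an integer). -/
def c5Q (n : ℕ) : ℤ := QOf (aC5 n)

/-- `P_n = ρ(a·n)·(W(b′)V(b) − W(b)V(b′))`, the rational companion of `Q_n` given by the wedge dictionary. -/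
def c5P (n : ℕ) : ℚ :=
  rhoOf (aC5 n) * (coeffW (bC5' n) * coeffV (bC5 n) - coeffW (bC5 n) * coeffV (bC5' n))

/-- The approximating form `L_n = ρ(a·n)·(W(b′)·F̃₇(b) − W(b)·F̃₇(b′))` of the ray. -/
def c5Form (n : ℕ) : ℝ :=
  (rhoOf (aC5 n) : ℝ) *
    ((coeffW (bC5' n) : ℝ) * vwpDual 7 (bC5 n) - (coeffW (bC5 n) : ℝ) * vwpDual 7 (bC5' n))

/-! ### Slot bookkeeping -/

/-- The values of `βC5`. -/
theorem βC5_values : βC5 0 = 21 ∧ βC5 1 = 19 ∧ βC5 2 = 18 ∧ βC5 3 = 16 ∧ βC5 4 = 15 ∧ βC5 5 = 13 ∧ βC5 6 = 12 := by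
  simp [βC5]

/-- Every slot is at most `21`. -/
theorem βC5_le (j : ℕ) : βC5 j ≤ 21 := by
  unfold βC5; split_ifs <;> omega

/-- Every slot `j < 7` is at least `12`. -/
theorem βC5_ge {j : ℕ} (hj : j < 7) : 12 ≤ βC5 j := by
  unfold βC5; split_ifs <;> omega

/-- `Σ_{j<7} β_{j+1} = 114`. -/
theorem sum_βC5 : ∑ j ∈ range 7, βC5 j = 114 := by
  simp [sum_range_succ, βC5]

/-- `bC5 n 0 = 51n`. -/
theorem bC5_zero (n : ℕ) : bC5 n 0 = 51 * n := by simp [bC5, natB]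

/-- The slots of `bC5 n`: `bC5 n (j+1) = β_{j+1}·n` for `j < 7`. -/
theorem bC5_succ (n : ℕ) {j : ℕ} (hj : j ∈ range 7) : bC5 n (j + 1) = (βC5 j * n : ℕ) := by
  have hj' := mem_range.1 hj
  simp [bC5, natB_succ _ _ hj, BC5E]

/-- `b(a·n) = bC5 n`. -/
theorem bOfA_aC5 (n : ℕ) : bOfA (aC5 n) = bC5 n := by
  funext j
  rcases j with _ | _ | _ | _ | _ | _ | _ | _ | k
  all_goals simp [bOfA, aC5, c5Vec, bC5, natB, BC5E, βC5]
  all_goals ring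

/-- `bC5' n = bC5 n + e₇`. -/
theorem bC5'_eq_update (n : ℕ) : bC5' n = Function.update (bC5 n) 7 (bC5 n 7 + 1) := by
  funext j
  by_cases hj : j = 7
  · subst hj
    simp [Function.update, bC5, bC5', natB, BC5E, βC5]
  · rw [Function.update_of_ne hj]
    unfold bC5 bC5' natB BC5E
    have h6 : j - 1 ≠ 6 ∨ j = 0 := by omega
    rcases h6 with h6 | h0
    · simp [h6]
    · subst h0; simp

/-- The box conditions of the natural slots: `B_j ≤ 51n` (`e ≤ 1`, `n ≥ 1`). -/
theorem hle_c5E {e n : ℕ} (he : e ≤ 1) (hn : 1 ≤ n) : ∀ j ∈ range 7, BC5E e n j ≤ 51 * n := by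
  intro j hj
  unfold BC5E
  have := βC5_le j
  split_ifs <;> nlinarith

/-- The region conditions `2B_j ≤ 51n + 1` (`e ≤ 1`, `n ≥ 1`). -/
theorem hreg_c5E {e n : ℕ} (he : e ≤ 1) (hn : 1 ≤ n) : ∀ j ∈ range 7, 2 * BC5E e n j ≤ 51 * n + 1 := by
  intro j hj
  unfold BC5E
  have := βC5_le j
  split_ifs <;> nlinarith

/-- The summability condition `Σ_j B_j ≤ 3·51n + 1` (`e ≤ 1`). -/
theorem hsum_c5E {e n : ℕ} (he : e ≤ 1) : ∑ j ∈ range 7, BC5E e n j ≤ 3 * (51 * n) + 1 := by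
  have h : ∑ j ∈ range 7, BC5E e n j = 114 * n + e := by
    simp [sum_range_succ, BC5E, βC5]; ring
  rw [h]; omega

/-! ### Side conditions on the ray -/

/-- The parameters `a·n` converge for every `n` (all seventeen forms (3) are non-negative multiples of `n`). -/
theorem converges_aC5 (n : ℕ) : Converges (aC5 n) := by
  intro x hx
  simp only [convergenceForms, aC5, c5Vec, List.mem_cons, List.not_mem_nil, or_false,
    Matrix.cons_val_zero, Matrix.cons_val_one, Matrix.cons_val] at hx
  omega

/-- The region of the wedge dictionary: `0 ≤ b_i` and `2b_i ≤ b₀ + 1` for `i = 1,…,7`. -/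
theorem region_aC5 (n : ℕ) : ∀ i ∈ Icc 1 7, 0 ≤ bOfA (aC5 n) i ∧ 2 * bOfA (aC5 n) i ≤ bOfA (aC5 n) 0 + 1 := by
  intro i hi
  obtain ⟨j, rfl⟩ : ∃ j, i = j + 1 := ⟨i - 1, by have := (mem_Icc.1 hi).1; omega⟩
  have hj : j ∈ range 7 := by have := (mem_Icc.1 hi).2; exact mem_range.2 (by omega)
  rw [bOfA_aC5, bC5_zero, bC5_succ n hj]
  have := βC5_le j
  constructor
  · positivity
  · push_cast; nlinarith [(Nat.cast_nonneg n : (0 : ℤ) ≤ n), (by exact_mod_cast this : (βC5 j : ℤ) ≤ 21)]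

/-- `d(b(a·n)) = 39n`. -/
theorem dOf_aC5 (n : ℕ) : dOf (bOfA (aC5 n)) = 39 * n := by
  rw [dOf_bOfA]
  simp [aC5, c5Vec]
  ring

/-- The box of `DualSeries` holds on the ray. -/
theorem inBox_bC5 (n : ℕ) : InBox (bC5 n) := by
  refine ⟨by rw [bC5_zero]; positivity, fun j hj => ?_⟩
  rw [bC5_zero, bC5_succ n hj]
  have := βC5_le j
  constructor
  · positivity
  · push_cast; nlinarith [(Nat.cast_nonneg n : (0 : ℤ) ≤ n), (by exact_mod_cast this : (βC5 j : ℤ) ≤ 21)]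

/-- The partner `j = 7` is admissible for `n ≥ 1`: `2(b₇ + 1) ≤ b₀ + 1`. -/
theorem partner_aC5 {n : ℕ} (hn : 1 ≤ n) : 2 * (bOfA (aC5 n) 7 + 1) ≤ bOfA (aC5 n) 0 + 1 := by
  rw [bOfA_aC5, bC5_zero, bC5_succ n (by simp)]
  simp only [βC5]
  push_cast
  have : (1 : ℤ) ≤ n := by exact_mod_cast hn
  nlinarith

/-! ### The two identities -/

/-- **Q-part of the wedge dictionary on the ray**: for `n ≥ 1`,
`Q(a·n) = ρ(a·n)·(U(b)W(b′) − U(b′)W(b))` with `b = bC5 n`, `b′ = b + e₇`. -/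
theorem c5Q_eq_wedge {n : ℕ} (hn : 1 ≤ n) :
    (c5Q n : ℚ) = rhoOf (aC5 n) *
      (coeffU (bC5 n) * coeffW (bC5' n) - coeffU (bC5' n) * coeffW (bC5 n)) := by
  have h := wedgeDictionary_Q (aC5 n) 7 (by simp) (converges_aC5 n) (region_aC5 n)
    (by rw [dOf_aC5]; positivity) (partner_aC5 hn)
  rw [bC5'_eq_update]
  simpa only [c5Q, bOfA_aC5] using h

/-- **The ray's forms are `Q(a·n)ζ(5) − P_n`**: for `n ≥ 1`,
`ρ(a·n)·(W(b′)F̃₇(b) − W(b)F̃₇(b′)) = Q(a·n)·ζ(5) − P_n` (ζ(3)-elimination + the Q-part of the dictionary). -/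
theorem c5Form_eq {n : ℕ} (hn : 1 ≤ n) :
    c5Form n = (c5Q n : ℝ) * zetaValue 5 - (c5P n : ℝ) := by
  have hd : 0 ≤ dOf (bC5 n) := by rw [← bOfA_aC5, dOf_aC5]; positivity
  have hle : bC5 n 7 ≤ bC5 n 0 := by
    rw [bC5_zero, bC5_succ n (by simp)]; simp only [βC5]; push_cast; nlinarith
  have h3 := zeta3_elimination (bC5 n) (inBox_bC5 n) hd (j := 7) (by simp) hle
  have hQ : ((c5Q n : ℚ) : ℝ) = ((rhoOf (aC5 n) *
      (coeffU (bC5 n) * coeffW (bC5' n) - coeffU (bC5' n) * coeffW (bC5 n)) : ℚ) : ℝ) := by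
    rw [c5Q_eq_wedge hn]
  unfold c5Form c5P
  rw [show ((c5Q n : ℤ) : ℝ) = ((c5Q n : ℚ) : ℝ) by norm_cast, hQ]
  rw [bC5'_eq_update] at *
  rw [h3]
  push_cast
  ring

end Summit.KontsevichZagierPeriods.Zeta5Search.RayC5
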